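import Mathlib.Geometry.Manifold.Instances.Sphere
import Mathlib.Geometry.Manifold.Diffeomorph
import Mathlib.AlgebraicTopology.FundamentalGroupoid.SimplyConnected
import Literature.Geometry.Riemannian.IsotropicCurvature
import HarnessLib

/-!
# Named fact: compact simply connected 4-manifolds with positive isotropic curvature are `S⁴`
(Hamilton 1997; Chen–Tang–Zhu 2012)

Topic `Literature/Geometry/Riemannian`; cite item `wi-03812` (route SmoothPoincare4/PIC), over
the tree's `PseudoRiemannianMetric.HasPositiveIsotropicCurvature` (`IsotropicCurvature.lean`).

**Hamilton 1997, Main Theorem 1.1 (p. 2) and Corollary 1.2(a) (p. 3); Chen–Zhu 2006 and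
Chen–Tang–Zhu 2012, Main Theorem** (complete proof of the surgery procedure; Chen–Tang–Zhu also
remove the space-form hypothesis). A compact 4-manifold admitting a metric of positive isotropic
curvature and containing no essential incompressible space form is diffeomorphic to `S⁴`, `ℝP⁴`,
`S³ × S¹`, `S³ ×~ S¹` or a connected sum of these; in particular (Hamilton 1997, Cor. 1.2(a),
p. 3: "If `M⁴` is a compact four-manifold with positive isotropic curvature, then (a) if `π₁ = {1}`,
`M⁴` is diffeomorphic to `S⁴`") a compact SIMPLY CONNECTED 4-manifold with a PIC metric is
diffeomorphic to `S⁴`. Proof: Ricci flow with surgery. (Locators regrounded 2026-08-14: in the arXiv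
version 0810.1999 of Chen–Tang–Zhu the results are "Theorem (Hamilton)" and the torsion-free remark,
p. 3, and "Main Theorem", p. 4; its Corollaries 1–2 concern Schoen's conjecture and conformally flat
metrics of positive scalar curvature, not the simply connected case.)

We vend the simply connected corollary, in the unbundled manifold format of
`SmoothPoincareConjectureFour` (`Summits/SmoothPoincare4/Statement.lean`): `M : Type` Hausdorff,
second countable, compact, `ChartedSpace (EuclideanSpace ℝ (Fin 4))`, `IsManifold (𝓡 4) ∞`,
`SimplyConnectedSpace`; hypothesis: a `C^∞` RIEMANNIAN (`IsRiemannian`) metric on `TM` with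
`HasPositiveIsotropicCurvature`; conclusion: `Nonempty (M ≃ₘ⟮𝓡 4, 𝓡 4⟯ 𝕊⁴)`. Nothing asserted.

## References

* R. S. Hamilton, *Four-manifolds with positive isotropic curvature*, Comm. Anal. Geom. 5 (1997)
  1–92, Thm. 1.1 (p. 2), Cor. 1.2(a) (p. 3).
* B.-L. Chen, S.-H. Tang, X.-P. Zhu, *Complete classification of compact four-manifolds with
  positive isotropic curvature*, J. Differential Geom. 91 (2012) 41–80 (arXiv:0810.1999: Theorem
  (Hamilton) p. 3, Main Theorem p. 4).
* B.-L. Chen, X.-P. Zhu, *Ricci flow with surgery on four-manifolds with positive isotropic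
  curvature*, J. Differential Geom. 74 (2006) 177–264.
* M. Micallef, J. D. Moore, Ann. of Math. 127 (1988) (PIC; `π₁ = 0` & PIC ⇒ homeomorphic to `Sⁿ`).
-/

noncomputable section

open scoped Manifold ContDiff
open Literature.Geometry.Lorentzian

namespace Literature.Geometry.Riemannian

/-- Local notation: the standard `4`-sphere. -/
local notation "𝕊⁴" => (Metric.sphere (0 : EuclideanSpace ℝ (Fin 5)) 1)

/-- NAMED FACT (**Hamilton 1997, Cor. 1.2(a) of Thm. 1.1; complete proof Chen–Zhu 2006 /
Chen–Tang–Zhu 2012, Main Theorem — simply connected case**): every compact simply connected smooth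
4-manifold carrying a smooth Riemannian metric of positive isotropic curvature is diffeomorphic to
`S⁴`. Users take `(h : hamilton_chen_tang_zhu)`. [Hamilton 1997, Thm. 1.1 (p. 2) and Cor. 1.2(a)
(p. 3); Chen–Tang–Zhu 2012, §1 Theorem (Hamilton) and Main Theorem]
[cite: Hamilton1997, Cor. 1.2(a) (p. 3)] [cite: ChenTangZhu2012, §1, Theorem (Hamilton) and Main Theorem] -/
def hamilton_chen_tang_zhu : Prop :=
  ∀ (M : Type) [TopologicalSpace M] [T2Space M] [SecondCountableTopology M] [CompactSpace M]
    [ChartedSpace (EuclideanSpace ℝ (Fin 4)) M] [IsManifold (𝓡 4) ∞ M] [SimplyConnectedSpace M],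
    (∃ g : PseudoRiemannianMetric (𝓡 4) ∞ (EuclideanSpace ℝ (Fin 4)) (TangentSpace (𝓡 4) : M → Type _),
        g.IsRiemannian ∧ g.HasPositiveIsotropicCurvature) →
      Nonempty (M ≃ₘ⟮𝓡 4, 𝓡 4⟯ 𝕊⁴)

/-- The route-facing consequence: a compact simply connected 4-manifold with a PIC metric that
is NOT diffeomorphic to `S⁴` would contradict Hamilton–Chen–Tang–Zhu; equivalently, an exotic
`S⁴` carries no PIC metric. [Hamilton 1997, §1; Chen–Tang–Zhu 2012, §1] [folklore] -/
theorem isEmpty_diffeomorph_false (h : hamilton_chen_tang_zhu)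
    (M : Type) [TopologicalSpace M] [T2Space M] [SecondCountableTopology M] [CompactSpace M]
    [ChartedSpace (EuclideanSpace ℝ (Fin 4)) M] [IsManifold (𝓡 4) ∞ M] [SimplyConnectedSpace M]
    (g : PseudoRiemannianMetric (𝓡 4) ∞ (EuclideanSpace ℝ (Fin 4)) (TangentSpace (𝓡 4) : M → Type _))
    (hg : g.IsRiemannian) (hpic : g.HasPositiveIsotropicCurvature)
    (hex : IsEmpty (M ≃ₘ⟮𝓡 4, 𝓡 4⟯ 𝕊⁴)) : False :=
  hex.false (h M ⟨g, hg, hpic⟩).some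

end Literature.Geometry.Riemannian
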